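import Summits.FinalStateConjecture.FinalStateConjecture.Theses.EIHFluxBalance

/-!
# S1 `stub_coneTransportLuminosity` (line old-light-leaves-the-cone, crux stmt-FinalStateConjecture-10166):
# MIS-STATED at `N = 0`, and — once corrected — BLOCKED on one precise chart-level theorem

SCRATCH of the stub-worker for `stub_coneTransportLuminosity` (2026-08-16). NOT a landing candidate: it contains two
`Prop` definitions (the audit classes them `vendored-fact`) and proves the (corrected) stub only FROM them. Everything in
this file elaborates (`lean check` rc 0, 0 sorries, axioms `propext/Classical.choice/Quot.sound`).

## Finding 1 — the registered signature is mis-stated at `N = 0` (`coneWeight_eq_one_of_isEmpty`)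

The cone weight of the antecedent is `1 + √(√((⨅ i, ‖x̲ − ξᵢ t‖) ^ 7))` with `⨅` over `i : Fin N` in `ℝ`. For `N = 0`
this is `1 + √(√((sInf ∅) ^ 7)) = 1` (`Real.iInf_of_isEmpty`): the "weighted" clause degenerates to the UNWEIGHTED `C³` sup
over the solid cone, so NO retarded/advanced rate can be read anywhere — the line's lever ("old light leaves the cone")
does not exist at `N = 0`, yet the registered S1 still claims an `L¹(dt)` window luminosity for every dispersing MGHD.
That `N = 0` statement is a large-data late-time DECAY-RATE theorem (no rate in, `L¹` rate out), out of reach and not what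
the line means; its chart-level form is refuted already at the linearised level by the bounded oscillatory tail
`φ = (F(t−r) − F(t+r))/r`, `F(s) = −s^{-1/2} cos s` (`s ≥ 1`): all `∂^{≤3}φ → 0` uniformly on the slabs (like `t^{-1/2}`),
but the flux through `S(0, R)`, `R ≍ κt/4`, is `≍ cos²(t − R)/(t − R) ≍ 1/t ∉ L¹` and is not absorbed by `C/R⁴ ≍ t⁻⁴`
(infinite, log-divergent energy — so it refutes the chart-level lemma, not the MGHD statement, whose `N = 0` truth is
simply unknown). With `N ≥ 1` the same tail violates the weighted clause at the cone wall (`t^{7/4}·t^{-1/2}/t → ∞`), as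
the line intends. The crux at `N = 0` is closed independently (`Theorems.inertialRecession_noHoles`, p68340), so the
correction is: insert `0 < N →` after the antecedent (corrected text = the statement of
`stub_coneTransportLuminosity_corrected_of` below minus its two hypotheses; S2 takes the same conclusion as input).

## Finding 2 — the corrected stub is exactly (A) + (B) away, and (A) exists nowhere

* `ConeTransportLuminosityChart` (A) — THE MISSING ANALYTIC THEOREM, chart level, painting- and spacetime-free, `0 < N`:
  for a smooth nondegenerate Ricci-flat field of bilinear forms `g` on an open `V ⊆ E4` containing the late exterior
  region `{τ₁ < x⁰, rᵢ > rinᵢ ∀ i}` of the modulated multi-Kerr–Schild ansatz `A` (same kinematic clauses as the crux),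
  the two sup-norm clauses of the crux for `g − A` on the slabs of `V` imply the window curvature-luminosity bound
  `∫_{S(c,R)} Σ|Riem g|² dμHE[2] ≤ C/R⁴ + ℓ(t)`, `ℓ ∈ L¹(T, ∞)`. Not in the tree, not in print: it needs Bianchi /
  Bel–Robinson `r^p`-type transport on truncated cones of a MULTI-CENTRE background with SUP-NORM inputs only
  (Dafermos–Rodnianski arXiv:0910.4957 and Moschidis arXiv:1509.08495 treat scalar `□_g ψ = 0` with weighted initial
  energies; Christodoulou–Klainerman 1993 is `N = 0` small data). Closest in tree: `Kerr.rpOne_divergence_inequality` /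
  `Kerr.rpTwo_divergence_inequality` (`KerrRpDivergence`: scalar waves, ONE fixed Kerr, pointwise), the density
  `LorentzianMetric.superenergyDensity` (`BelRobinsonEnergy`, no divergence identity), the coordinate second Bianchi
  identity `MetricCoord.IsMetricOn.covRiemAt_cyclic` (`CoordBianchi`) and `div W = 0` (`CoordWeylBianchi`).
* `LabMetricChartVacuum` (B) — BOOKKEEPING, provable in principle from the tree (size M–L, not attempted here): under the
  antecedent the lab metric `gLab = A + deviationExtend ⟨U,…⟩ Φ` (`= Φ^*g` on `U`, `Spacetime.deviationExtend_coe`) is,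
  on some open `V` with `{T₁ < x⁰, rᵢ > rinᵢ} ⊆ V ⊆ U`, a `MetricCoord.IsMetricOn` field with `MetricCoord.ricAt gLab = 0`
  (nondegeneracy: `deviationCk → 0` + uniform nondegeneracy of `A` once the holes are separated, boosts stretch spatial
  vectors so `{rⱼ ≤ R}` lies in the lab ball of radius `√(R² + aⱼ²)` about `ξⱼ`; smoothness:
  `Spacetime.contDiffAt_deviationExtend_model`; vacuum: `𝒟.isRicciFlat` + `ricci_comap_apply` (`CurvatureNaturality`) +
  `ricci_eq_ricAt` (`ChartMetricCoord`), `Φ` being a local diffeomorphism where `Φ^*g` is nondegenerate).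
* `stub_coneTransportLuminosity_corrected_of : (A) → (B) → <registered S1 signature with `0 < N →` inserted>` — the
  reduction, kernel-checked (sup-norm monotonicity under `V ⊆ U`, and `gLab − A = deviationExtend` pointwise).

No cheap route exists: the antecedent is not contradictory (Minkowski/`N = 0` inhabits its shape), the window spheres
lie in `U` for `R₀ > maxᵢ √(rinᵢ² + aᵢ²)/δ` (so `riemAt gLab` is honest curvature there, no junk), `R ≥ R₀ ≥ 1` is ours to
choose (no `R ≤ 0` junk), and the Bochner integral over `Metric.sphere c R` of the continuous integrand is an honest
surface integral.
-/

set_option linter.dupNamespace false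
set_option linter.unusedVariables false
set_option linter.style.longLine false

noncomputable section

namespace Summit.FinalStateConjecture.FinalStateConjecture.Theorems

open scoped BigOperators Topology Manifold Classical MeasureTheory Matrix InnerProductSpace ContDiff ENNReal
open Filter Set Function TopologicalSpace MeasureTheory Literature.Geometry.Lorentzian
open Summit.FinalStateConjecture.FinalStateConjecture.Theses.EIHFluxBalance

/-! ### Two monotonicity helpers (sup norms over a smaller set, of a pointwise-equal function) -/

/-- `supCkENorm` is monotone in the set and invariant under pointwise-equal functions. [folklore] -/
theorem supCkENorm_le_of_subset_of_eq {S T : Set E4} {f g : E4 → E4 →L[ℝ] E4 →L[ℝ] ℝ} (hST : S ⊆ T)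
    (hfg : ∀ x, f x = g x) (k : ℕ) : supCkENorm S k f ≤ supCkENorm T k g := by
  rw [show f = g from funext hfg]
  exact supCkENorm_mono hST k g

/-- The weighted double supremum over `V ∩ {P}` (points of `E4`) is bounded by the one over `{x : U | P x}` when
`V ⊆ U`, for pointwise-equal functions. [folklore] -/
theorem iSup_weight_le_of_subset_of_eq {U : Opens E4} {V : Set E4} (hVU : V ⊆ (U : Set E4))
    {f g : E4 → E4 →L[ℝ] E4 →L[ℝ] ℝ} (hfg : ∀ x, f x = g x) (w : E4 → ℝ≥0∞) (P : E4 → Prop) :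
    (⨆ x ∈ (V ∩ {x : E4 | P x}), ⨆ (m : ℕ) (_ : m ≤ 3), w x * ‖iteratedFDeriv ℝ m f x‖ₑ) ≤
      ⨆ x ∈ {x : U | P x.1}, ⨆ (m : ℕ) (_ : m ≤ 3), w x.1 * ‖iteratedFDeriv ℝ m g x.1‖ₑ := by
  rw [show f = g from funext hfg]
  refine iSup₂_le fun x hx ↦ ?_
  have hx' : (⟨x, hVU hx.1⟩ : U) ∈ {y : U | P y.1} := hx.2
  exact le_iSup₂_of_le (f := fun (y : U) (_ : y ∈ {y : U | P y.1}) ↦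
    ⨆ (m : ℕ) (_ : m ≤ 3), w y.1 * ‖iteratedFDeriv ℝ m g y.1‖ₑ) ⟨x, hVU hx.1⟩ hx' le_rfl

/-! ### The `N = 0` degeneracy of the registered weight -/

/-- **At `N = 0` the cone weight of the crux antecedent is identically `1`**: `⨅` over the empty index type `Fin 0`
is `sInf ∅ = 0` in `ℝ`, so `1 + √(√((⨅ i, dᵢ) ^ 7)) = 1` — the "weighted" clause is then the UNWEIGHTED `C³` sup
over the solid cone and carries no retarded/advanced rate. [folklore] -/
theorem coneWeight_eq_one_of_isEmpty (d : Fin 0 → ℝ) : ENNReal.ofReal (1 + √(√((⨅ i, d i) ^ 7))) = 1 := by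
  rw [Real.iInf_of_isEmpty d]
  simp

/-- **(A) Chart-level cone-transport luminosity — THE MISSING THEOREM (unproved; not in the tree, not in print).**
For a smooth nondegenerate Ricci-flat `g` on an open `V ⊇ {τ₁ < x⁰, rᵢ > rinᵢ}` whose deviation from the modulated
multi-Kerr–Schild ansatz satisfies the two sup-norm clauses of the crux, the coordinate curvature flux through every
admissible window sphere is `≤ C/R⁴ + ℓ(t)` with one `ℓ ∈ L¹(T, ∞)`. [conjectural; arXiv:0910.4957, arXiv:1509.08495,
ChristodoulouKlainerman1993PMS41 are the nearest technology] -/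
def ConeTransportLuminosityChart : Prop :=
  ∀ (N : ℕ) (M a rin : Fin N → ℝ) (Λ : Fin N → ℝ → lorentzGroup) (ξ : Fin N → ℝ → E3) (γ κ τ₁ : ℝ)
    (g : E4 → E4 →L[ℝ] E4 →L[ℝ] ℝ) (V : Set E4),
    0 < N →
    (∀ i, Kerr.IsSubextremal (M i) (a i) ∧ Kerr.rMinus (M i) (a i) < rin i ∧ rin i < Kerr.rPlus (M i) (a i)) →
    (∀ i t, |((Λ i t : E4 ≃L[ℝ] E4) (E4.basisVector 0)) 0| ≤ γ) →
    (∀ i, ContDiff ℝ ((⊤ : ℕ∞) : WithTop ℕ∞) (ξ i) ∧ ContDiff ℝ ((⊤ : ℕ∞) : WithTop ℕ∞) (fun t ↦ ((Λ i t : E4 ≃L[ℝ] E4) : E4 →L[ℝ] E4))) →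
    (∀ i j, i ≠ j → Tendsto (fun t ↦ ‖ξ i t - ξ j t‖) atTop atTop) →
    (0 < κ ∧ κ < 1 ∧ ∀ i, ∀ᶠ t in atTop, ‖ξ i t‖ ≤ κ ^ 2 * t) →
    IsOpen V → {x : E4 | τ₁ < x 0 ∧ ∀ i, rin i < Kerr.radius (a i) (poincareInv (Λ i (x 0)) (E4.ofTimeSpace (x 0) (ξ i (x 0))) x)} ⊆ V →
    MetricCoord.IsMetricOn g V → (∀ x ∈ V, MetricCoord.ricAt g x = 0) →
    Tendsto (fun t : ℝ ↦ supCkENorm (V ∩ {x : E4 | x 0 = t}) 3 (fun x : E4 ↦ g x - (Minkowski.bilin + ∑ i, (boostedKerrBilin (Λ i (x 0)) (E4.ofTimeSpace (x 0) (ξ i (x 0))) (M i) (a i) x - Minkowski.bilin)))) atTop (𝓝 0) →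
    Tendsto (fun t : ℝ ↦ ⨆ x ∈ (V ∩ {x : E4 | x 0 = t ∧ E4.spatialNorm x ≤ κ * t}), ⨆ (m : ℕ) (_ : m ≤ 3), ENNReal.ofReal (1 + √(√((⨅ i, ‖E4.spatial x - ξ i t‖) ^ 7))) * ‖iteratedFDeriv ℝ m (fun x : E4 ↦ g x - (Minkowski.bilin + ∑ i, (boostedKerrBilin (Λ i (x 0)) (E4.ofTimeSpace (x 0) (ξ i (x 0))) (M i) (a i) x - Minkowski.bilin))) x‖ₑ) atTop (𝓝 0) →
    ∀ δ : ℝ, 0 < δ → δ < 1 → ∃ (C R₀ T : ℝ) (ℓ : ℝ → ℝ), IntegrableOn ℓ (Set.Ioi T) ∧ ∀ (t : ℝ) (c : E3) (R : ℝ), T ≤ t → (R₀ ≤ R ∧ ‖c‖ + R ≤ (κ + κ ^ 2) / 2 * t ∧ ∀ j, ‖ξ j t - c‖ ≤ (1 - δ) * R ∨ (1 + δ) * R ≤ ‖ξ j t - c‖) → ∫ y in Metric.sphere c R, (∑ μ : Fin 4, ∑ ν : Fin 4, ∑ α : Fin 4, ∑ β : Fin 4, (MetricCoord.riemAt g (E4.ofTimeSpace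 t y) (E4.basisVector μ) (E4.basisVector ν) (E4.basisVector α) β) ^ 2) ∂(μHE[2] : Measure E3) ≤ C / R ^ 4 + ℓ t

/-- **(B) Lab-metric vacuum bookkeeping (provable in principle from the tree).** Under the crux antecedent the lab
metric is a smooth nondegenerate Ricci-flat field of bilinear forms on an open set between the late exterior region and
`U`. [folklore] -/
def LabMetricChartVacuum : Prop :=
  ∀ (X : Type) [TopologicalSpace X] [ChartedSpace E3 X] [IsManifold (𝓡 3) ((⊤ : ℕ∞) : WithTop ℕ∞) X] [T2Space X] [SecondCountableTopology X] [ConnectedSpace X], ∀ D ∈ admissibleVacuumData X, ∀ 𝒟 : VacuumCauchyDevelopment D, 𝒟.IsMaximal → ∀ (N : ℕ) (M a rin : Fin N → ℝ) (Λ : Fin N → ℝ → lorentzGroup) (ξ : Fin N → ℝ → E3) (γ κ τ₀ : ℝ) (U : Opens E4) (Φ : U → 𝒟.carrier) (O : Set 𝒟.carrier), ((∀ i, Kerr.IsSubextremal (M i) (a i) ∧ Kerr.rMinus (M i) (a i) < rin i ∧ rin i < Kerr.rPlus (M i) (a i)) ∧ (∀ i t, |((Λ i t : E4 ≃L[ℝ]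 E4) (E4.basisVector 0)) 0| ≤ γ) ∧ (∀ i, ContDiff ℝ ((⊤ : ℕ∞) : WithTop ℕ∞) (ξ i) ∧ ContDiff ℝ ((⊤ : ℕ∞) : WithTop ℕ∞) (fun t ↦ ((Λ i t : E4 ≃L[ℝ] E4) : E4 →L[ℝ] E4))) ∧ (∀ i j, i ≠ j → Tendsto (fun t ↦ ‖ξ i t - ξ j t‖) atTop atTop) ∧ (0 < κ ∧ κ < 1 ∧ ∀ i, ∀ᶠ t in atTop, ‖ξ i t‖ ≤ κ ^ 2 * t) ∧ ({x : E4 | τ₀ < x 0 ∧ ∀ i, rin i < Kerr.radius (a i) (poincareInv (Λ i (x 0)) (E4.ofTimeSpace (x 0) (ξ i (x 0))) x)} ⊆ (U : Set E4)) ∧ let B : ModelBackground := ⟨U, fun x ↦ Minkowski.bilin + ∑ i, (boostedKerrBilin (Λ i (x 0)) (E4.ofTimeSpace (x 0) (ξ i (x 0))) (M i) (a i) x - Minkowski.bilin), fun x ↦ x 0, E4.spatialNorm⟩; ContMDiff 𝓘(ℝ, E4) (𝓡 4) ((⊤ : ℕ∞) : WithTop ℕ∞) Φ ∧ Topology.IsOpenEmbedding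 ((B.lateRegion τ₀).restrict Φ) ∧ Φ '' {x : U | τ₀ < x.1 0 ∧ ∀ i, Kerr.rPlus (M i) (a i) < Kerr.radius (a i) (poincareInv (Λ i (x.1 0)) (E4.ofTimeSpace (x.1 0) (ξ i (x.1 0))) x.1)} ⊆ O ∧ Tendsto (fun t ↦ 𝒟.toSpacetime.deviationCk B Φ 3 t) atTop (𝓝 0) ∧ Tendsto (fun t : ℝ ↦ ⨆ x ∈ {x : U | x.1 0 = t ∧ E4.spatialNorm x.1 ≤ κ * t}, ⨆ (m : ℕ) (_ : m ≤ 3), ENNReal.ofReal (1 + √(√((⨅ i, ‖E4.spatial x.1 - ξ i t‖) ^ 7))) * ‖iteratedFDeriv ℝ m (𝒟.toSpacetime.deviationExtend B Φ) x.1‖ₑ) atTop (𝓝 0) ∧ O = Summit.FinalStateConjecture.exteriorOf 𝒟.toCauchyDevelopment (Φ '' {x : U | τ₀ < x.1 0 ∧ ∀ i, Kerr.rPlus (M i) (a i) < Kerr.radius (a i) (poincareInv (Λ i (x.1 0)) (E4.ofTimeSpace (x.1 0) (ξ i (x.1 0))) x.1)}) ∧ ∀ t₁ : ℝ, τ₀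 < t₁ → O \ Φ '' {x : U | t₁ < x.1 0 ∧ ∀ i, Kerr.rPlus (M i) (a i) < Kerr.radius (a i) (poincareInv (Λ i (x.1 0)) (E4.ofTimeSpace (x.1 0) (ξ i (x.1 0))) x.1)} ⊆ 𝒟.metric.causalPast 𝒟.timeOrientation (Φ '' {x : U | x.1 0 = t₁ ∧ ∀ i, Kerr.rPlus (M i) (a i) < Kerr.radius (a i) (poincareInv (Λ i (x.1 0)) (E4.ofTimeSpace (x.1 0) (ξ i (x.1 0))) x.1)})) →
    ∃ (T₁ : ℝ) (V : Set E4), IsOpen V ∧ {x : E4 | T₁ < x 0 ∧ ∀ i, rin i < Kerr.radius (a i) (poincareInv (Λ i (x 0)) (E4.ofTimeSpace (x 0) (ξ i (x 0))) x)} ⊆ V ∧ V ⊆ (U : Set E4) ∧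
      MetricCoord.IsMetricOn (fun x : E4 ↦ (Minkowski.bilin + ∑ i, (boostedKerrBilin (Λ i (x 0)) (E4.ofTimeSpace (x 0) (ξ i (x 0))) (M i) (a i) x - Minkowski.bilin)) + 𝒟.toSpacetime.deviationExtend (⟨U, fun x ↦ Minkowski.bilin + ∑ i, (boostedKerrBilin (Λ i (x 0)) (E4.ofTimeSpace (x 0) (ξ i (x 0))) (M i) (a i) x - Minkowski.bilin), fun x ↦ x 0, E4.spatialNorm⟩ : ModelBackground) Φ x) V ∧
      ∀ x ∈ V, MetricCoord.ricAt (fun x : E4 ↦ (Minkowski.bilin + ∑ i, (boostedKerrBilin (Λ i (x 0)) (E4.ofTimeSpace (x 0) (ξ i (x 0))) (M i) (a i) x - Minkowski.bilin)) + 𝒟.toSpacetime.deviationExtend (⟨U, fun x ↦ Minkowski.bilin + ∑ i, (boostedKerrBilin (Λ i (x 0)) (E4.ofTimeSpace (x 0) (ξ i (x 0))) (M i) (a i) x - Minkowski.bilin), fun x ↦ x 0, E4.spatialNorm⟩ : ModelBackground) Φ x) x = 0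

/-- **Reduction (kernel-checked).** The CORRECTED stub — the registered signature of `stub_coneTransportLuminosity` with
`0 < N →` inserted after the antecedent, otherwise verbatim — follows from (A) and (B) by monotonicity of the sup norms in
the set (`V ⊆ U`) and `gLab − A = deviationExtend` pointwise. [folklore] -/
theorem stub_coneTransportLuminosity_corrected_of (hA : ConeTransportLuminosityChart) (hB : LabMetricChartVacuum) :
    ∀ (X : Type) [TopologicalSpace X] [ChartedSpace E3 X] [IsManifold (𝓡 3) ((⊤ : ℕ∞) : WithTop ℕ∞) X] [T2Space X] [SecondCountableTopology X] [ConnectedSpace X], ∀ D ∈ admissibleVacuumData X, ∀ 𝒟 : VacuumCauchyDevelopment D, 𝒟.IsMaximal → ∀ (N : ℕ) (M a rin : Fin N → ℝ) (Λ : Fin N → ℝ → lorentzGroup) (ξ : Fin N → ℝ → E3) (γ κ τ₀ : ℝ) (U : Opens E4) (Φ : U → 𝒟.carrier) (O : Set 𝒟.carrier), ((∀ i, Kerr.IsSubextremal (M i) (a i) ∧ Kerr.rMinus (M i) (a i) < rin i ∧ rin i < Kerr.rPlus (M i) (a i)) ∧ (∀ i t, |((Λ i t : E4 ≃L[ℝ]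 E4) (E4.basisVector 0)) 0| ≤ γ) ∧ (∀ i, ContDiff ℝ ((⊤ : ℕ∞) : WithTop ℕ∞) (ξ i) ∧ ContDiff ℝ ((⊤ : ℕ∞) : WithTop ℕ∞) (fun t ↦ ((Λ i t : E4 ≃L[ℝ] E4) : E4 →L[ℝ] E4))) ∧ (∀ i j, i ≠ j → Tendsto (fun t ↦ ‖ξ i t - ξ j t‖) atTop atTop) ∧ (0 < κ ∧ κ < 1 ∧ ∀ i, ∀ᶠ t in atTop, ‖ξ i t‖ ≤ κ ^ 2 * t) ∧ ({x : E4 | τ₀ < x 0 ∧ ∀ i, rin i < Kerr.radius (a i) (poincareInv (Λ i (x 0)) (E4.ofTimeSpace (x 0) (ξ i (x 0))) x)} ⊆ (U : Set E4)) ∧ let B : ModelBackground := ⟨U, fun x ↦ Minkowski.bilin + ∑ i, (boostedKerrBilin (Λ i (x 0)) (E4.ofTimeSpace (x 0) (ξ i (x 0))) (M i) (a i) x - Minkowski.bilin), fun x ↦ x 0, E4.spatialNorm⟩; ContMDiff 𝓘(ℝ, E4) (𝓡 4) ((⊤ : ℕ∞) : WithTop ℕ∞) Φ ∧ Topology.IsOpenEmbedding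 ((B.lateRegion τ₀).restrict Φ) ∧ Φ '' {x : U | τ₀ < x.1 0 ∧ ∀ i, Kerr.rPlus (M i) (a i) < Kerr.radius (a i) (poincareInv (Λ i (x.1 0)) (E4.ofTimeSpace (x.1 0) (ξ i (x.1 0))) x.1)} ⊆ O ∧ Tendsto (fun t ↦ 𝒟.toSpacetime.deviationCk B Φ 3 t) atTop (𝓝 0) ∧ Tendsto (fun t : ℝ ↦ ⨆ x ∈ {x : U | x.1 0 = t ∧ E4.spatialNorm x.1 ≤ κ * t}, ⨆ (m : ℕ) (_ : m ≤ 3), ENNReal.ofReal (1 + √(√((⨅ i, ‖E4.spatial x.1 - ξ i t‖) ^ 7))) * ‖iteratedFDeriv ℝ m (𝒟.toSpacetime.deviationExtend B Φ) x.1‖ₑ) atTop (𝓝 0) ∧ O = Summit.FinalStateConjecture.exteriorOf 𝒟.toCauchyDevelopment (Φ '' {x : U | τ₀ < x.1 0 ∧ ∀ i, Kerr.rPlus (M i) (a i) < Kerr.radius (a i) (poincareInv (Λ i (x.1 0)) (E4.ofTimeSpace (x.1 0) (ξ i (x.1 0))) x.1)}) ∧ ∀ t₁ : ℝ, τ₀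 < t₁ → O \ Φ '' {x : U | t₁ < x.1 0 ∧ ∀ i, Kerr.rPlus (M i) (a i) < Kerr.radius (a i) (poincareInv (Λ i (x.1 0)) (E4.ofTimeSpace (x.1 0) (ξ i (x.1 0))) x.1)} ⊆ 𝒟.metric.causalPast 𝒟.timeOrientation (Φ '' {x : U | x.1 0 = t₁ ∧ ∀ i, Kerr.rPlus (M i) (a i) < Kerr.radius (a i) (poincareInv (Λ i (x.1 0)) (E4.ofTimeSpace (x.1 0) (ξ i (x.1 0))) x.1)})) →
      0 < N → ∀ δ : ℝ, 0 < δ → δ < 1 → ∃ (C R₀ T : ℝ) (ℓ : ℝ → ℝ), IntegrableOn ℓ (Set.Ioi T) ∧ ∀ (t : ℝ) (c : E3) (R : ℝ), T ≤ t → (R₀ ≤ R ∧ ‖c‖ + R ≤ (κ + κ ^ 2) / 2 * t ∧ ∀ j, ‖ξ j t - c‖ ≤ (1 - δ) * R ∨ (1 + δ) * R ≤ ‖ξ j t - c‖) → ∫ y in Metric.sphere c R, (∑ μ : Fin 4, ∑ ν : Fin 4, ∑ α : Fin 4, ∑ β : Fin 4, (MetricCoord.riemAt (fun x : E4 ↦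 (Minkowski.bilin + ∑ i, (boostedKerrBilin (Λ i (x 0)) (E4.ofTimeSpace (x 0) (ξ i (x 0))) (M i) (a i) x - Minkowski.bilin)) + 𝒟.toSpacetime.deviationExtend (⟨U, fun x ↦ Minkowski.bilin + ∑ i, (boostedKerrBilin (Λ i (x 0)) (E4.ofTimeSpace (x 0) (ξ i (x 0))) (M i) (a i) x - Minkowski.bilin), fun x ↦ x 0, E4.spatialNorm⟩ : ModelBackground) Φ x) (E4.ofTimeSpace t y) (E4.basisVector μ) (E4.basisVector ν) (E4.basisVector α) β) ^ 2) ∂(μHE[2] : Measure E3) ≤ C / R ^ 4 + ℓ t := by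
  intro X _ _ _ _ _ _ D hD 𝒟 h𝒟 N M a rin Λ ξ γ κ τ₀ U Φ O hbig hN δ hδ hδ₁
  obtain ⟨T₁, V, hVo, hVsub, hVU, hmet, hric⟩ := hB X D hD 𝒟 h𝒟 N M a rin Λ ξ γ κ τ₀ U Φ O hbig
  obtain ⟨hsub, hlor, hsm, hsep, hcone, hU, hΦ, hemb, hO, hdev, hwt, hOeq, hexh⟩ := hbig
  refine hA N M a rin Λ ξ γ κ T₁ _ V hN hsub hlor hsm hsep hcone hVo hVsub hmet hric ?_ ?_ δ hδ hδ₁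
  · -- unweighted clause: `gLab − A = deviationExtend` pointwise and `V ∩ {x⁰ = t} ⊆ val '' timeSlab t`
    refine tendsto_of_tendsto_of_tendsto_of_le_of_le tendsto_const_nhds hdev (fun _ ↦ bot_le) fun t ↦
      supCkENorm_le_of_subset_of_eq ?_ (fun x ↦ add_sub_cancel_left _ _) 3
    rintro x ⟨hxV, hxt⟩
    exact ⟨⟨x, hVU hxV⟩, hxt, rfl⟩
  · -- weighted clause: same two facts, inside the double supremum
    exact tendsto_of_tendsto_of_tendsto_of_le_of_le tendsto_const_nhds hwt (fun _ ↦ bot_le) fun t ↦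
      iSup_weight_le_of_subset_of_eq hVU (fun x ↦ add_sub_cancel_left _ _)
        (fun x ↦ ENNReal.ofReal (1 + √(√((⨅ i, ‖E4.spatial x - ξ i t‖) ^ 7))))
        (fun x ↦ x 0 = t ∧ E4.spatialNorm x ≤ κ * t)

end Summit.FinalStateConjecture.FinalStateConjecture.Theorems

end
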